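/-
Copyright (c) 2026 the pub-hodgecm-mathlib formalisation cell (harness21).  Prover seat hodgecm-mathlib-K2E3-p05 (g3), Track B «K2-LIT», engine E3, unit U4 «Keys»; Road II′
(U4-f residue (R1): RAMIFIED places), PLACE-FREE criterion datum; 2026-09-04.  KERNEL module: THEOREMS ONLY (no definition, no named fact, no `sorry`, no instance, no notation).
-/
import Summits.HodgeConjecture.HodgeConjecture.Theorems.K2E3IwahoriLinePF                  -- ★-filed (this seat): II-3-PF `exists_iwahoriLine` over `hϖ`; brings II-1-PF, PS-LEVELS-PF, P1
import Summits.HodgeConjecture.HodgeConjecture.Theorems.K2E3ParahoricAveragePF            -- ★-filed (this seat): II-2-PF `avgProj_K0_eq ∕ avgProj_K1_eq` over `hϖ`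
import Summits.HodgeConjecture.HodgeConjecture.Theorems.K2E3ParahoricReducibilityCriterion -- ★ II-4abs p855172 (g0): `criterion_of_iwahoriLine`
import Summits.HodgeConjecture.HodgeConjecture.Theorems.F0P2pCmPrincipalSeriesInterface    -- ★ `isSmooth_cmPrincipalSeries`
import HarnessLib

/-!
# K2 ∕ E3 «EllipticInputs», unit U4 «Keys» — Road II′ (RAMIFIED places), PLACE-FREE LAYER II-4-PF «THE CRITERION INSTANTIATED» over the uniformiser token `hϖ`, and the arithmetic
# of the four cases with EQUAL indices `[K₀:I] = [K₁:I] = q + 1` (the ramified `U(3)` tree)   [Casselman1980 §3; Borel1976 §4; Keys1984 §7 Thm (2); Tits1979 §2.4]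

Cell hodgecm-mathlib (D-0151), FLOOR 0, Track B «K2-LIT», engine E3, crux item H413 = stmt-HodgeConjecture-24833 (route `HCCMUnconditional`, no route verbs); target BY NAME
`…K2E3EllipticInputs.U4Keys.sig_K2E3KeysThmTwoContracting` (U4-f), residue (R1) «ramified places» of MEMO v4 (Road II′).  Author K2E3-p05 (g3).  `--supports stmt-HodgeConjecture-24833
--as helper`; THEOREMS ONLY.  §1 = ★ p856874 `criterion_of_data` with `hd` replaced by `hϖ : |ϖ|_w = exp(−1)` (proof VERBATIM, calls re-pointed to ★ II-1-PF, II-2-PF, II-3-PF):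
for a REGULAR `χ` trivial (with `wχ`) on `T ∩ K_v`, `⊥ ≠ N ≠ ⊤`, `d·w̃ ∈ K₁`, transversals `R`, `R′`, the four-way disjunction of ★ `criterion_of_iwahoriLine` in `|R|`, `|R′|`,
`μ = χ(proj d)·δ_B^{1∕2}(d)`.  §2: the four equations solved when `|R| = |R′| = q + 1` and `μ = z⁻¹q`, `|z| < 1`, `q ≥ 2`: `μ ∈ {q², 1, −q, −q}`, i.e. `z ∈ {q⁻¹, q, −1, −1}`, so
`z = q⁻¹` — at a RAMIFIED place only Keys' point (a) `λ_s = |·|_E` survives for unramified `χ` (an unramified `η` cannot restrict to the ramified `ω_{E∕F}`).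
HONEST LABEL: HC_CM is proved only modulo the 7 printed citations (2 remaining named inputs: hLiu418 = stmt-HodgeConjecture-24832, h413 = stmt-HodgeConjecture-24833)
until rung 0 closes; count-neutral (no socket is paid; no printed citation is discharged).

## References
* [Casselman1980] W. Casselman, Compositio Math. 40 (1980), §3.  * [Borel1976] A. Borel, Invent. Math. 35 (1976), §4.  * [Keys1984] D. Keys, Compositio Math. 51 (1984), §7 Theorem (2) p. 126.
* [Rogawski1990] J. D. Rogawski, Ann. of Math. Stud. 123 (1990), §12.2 (1)(2) p. 173.  * [Tits1979] J. Tits, PSPM 33.1 (1979), §2.4 (the local index of the ramified `U(3)`).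
-/

set_option autoImplicit false
-- the mandated namespace has the single-problem summit's repeated segment (`HodgeConjecture.HodgeConjecture`)
set_option linter.dupNamespace false

noncomputable section

open NumberField IsDedekindDomain MeasureTheory
open scoped Matrix MatrixGroups NNReal WithZero
open Literature.NumberTheory Literature.NumberTheory.Automorphic Literature.NumberTheory.Automorphic.UnitaryGroup
open Literature.NumberTheory.Rogawski1990 Literature.NumberTheory.GaloisRepresentations

namespace Summit.HodgeConjecture.HodgeConjecture.Cruxes.H413.K2E3KeysThmTwoIwahoriCriterionPF

open Summit.HodgeConjecture.HodgeConjecture.Cruxes.H413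
open Summit.HodgeConjecture.HodgeConjecture.Cruxes.H413.F0P3cStCharTSStLevelsTransport
open Summit.HodgeConjecture.HodgeConjecture.Cruxes.H413.K2E3ParahoricReducibilityCriterion

/-! ## §1 The arithmetic of the four cases with equal indices -/

/-- **The four equations of ★ `criterion_of_iwahoriLine` with `|R| = |R′| = q + 1`, `μ = z⁻¹q`, `|z| < 1`, `q ≥ 2`, solved for `z`**: `μ ∈ {q², 1, −q, −q}`, so `z ∈ {q⁻¹, q, −1, −1}`
and `|z| < 1` leaves `z = q⁻¹` (pure algebra in `ℂ`; the local index `(q+1, q+1)` is that of the RAMIFIED quasi-split `U(3)`, both vertices special).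
[cite: Keys1984, §7 Theorem (2) (a) p. 126] [cite: Tits1979, §2.4] -/
theorem pair_algebra (q : ℕ) (hq : 2 ≤ q) (z μ : ℂ) (hz0 : z ≠ 0) (hz : ‖z‖ < 1) (hμ : μ = z⁻¹ * (q : ℂ))
    (h : ((q : ℂ) + 1)⁻¹ * (((q : ℂ) + 1)⁻¹ * μ) - ((q : ℂ) + 1)⁻¹ * ((q : ℂ) + 1 - 1) * (((q : ℂ) + 1)⁻¹ * ((q : ℂ) + 1 - 1)) = 0 ∨
      μ⁻¹ = 1 ∨ ((q : ℂ) + 1)⁻¹ * ((q : ℂ) + 1 - 1) + ((q : ℂ) + 1)⁻¹ * μ = 0 ∨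
      ((q : ℂ) + 1)⁻¹ + ((q : ℂ) + 1)⁻¹ * ((q : ℂ) + 1 - 1) * μ⁻¹ = 0) :
    z = ((q : ℂ))⁻¹ := by
  have hqR : (2 : ℝ) ≤ (q : ℝ) := by exact_mod_cast hq
  have hq0 : (q : ℂ) ≠ 0 := by exact_mod_cast (show q ≠ 0 by omega)
  have hm0 : (q : ℂ) + 1 ≠ 0 := by
    have : ((q : ℂ) + 1) = (((q : ℝ) + 1 : ℝ) : ℂ) := by push_cast; ring
    rw [this, Complex.ofReal_ne_zero]; positivity
  have hμ0 : μ ≠ 0 := by rw [hμ]; exact mul_ne_zero (inv_ne_zero hz0) hq0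
  have hzinv : ∀ c : ℂ, z⁻¹ * (q : ℂ) = c → z⁻¹ = c * ((q : ℂ))⁻¹ := fun c e => by
    rw [← e, mul_inv_cancel_right₀ hq0]
  rcases h with h | h | h | h
  · -- determinant: `μ = q·q`, `z = q⁻¹`
    have h' : ((q : ℂ) + 1) * ((q : ℂ) + 1) *
        (((q : ℂ) + 1)⁻¹ * (((q : ℂ) + 1)⁻¹ * μ) - ((q : ℂ) + 1)⁻¹ * ((q : ℂ) + 1 - 1) * (((q : ℂ) + 1)⁻¹ * ((q : ℂ) + 1 - 1))) =
        μ - (q : ℂ) * (q : ℂ) := by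
      field_simp
      ring
    rw [h, mul_zero] at h'
    have hμ' : μ = (q : ℂ) * (q : ℂ) := (sub_eq_zero.1 h'.symm)
    have e := hzinv _ (hμ.symm.trans hμ')
    rw [← inv_inv z, e]
    field_simp
  · -- `μ = 1`: `z = q`, too big
    exfalso
    have hμ1 : μ = 1 := inv_eq_one.1 h
    have e := hzinv _ (hμ.symm.trans hμ1)
    have hz' : z = (q : ℂ) := by rw [← inv_inv z, e, one_mul, inv_inv]
    have : ‖z‖ = (q : ℝ) := by rw [hz', Complex.norm_natCast]
    linarith
  · -- `μ = −q`: `z = −1`, not contracting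
    exfalso
    have h' : ((q : ℂ) + 1) * (((q : ℂ) + 1)⁻¹ * ((q : ℂ) + 1 - 1) + ((q : ℂ) + 1)⁻¹ * μ) = (q : ℂ) + μ := by
      field_simp
      ring
    rw [h, mul_zero] at h'
    have hμ' : μ = -(q : ℂ) := by linear_combination -h'
    have e := hzinv _ (hμ.symm.trans hμ')
    have hz' : z = -1 := by
      rw [← inv_inv z, e]
      field_simp
    have : ‖z‖ = 1 := by rw [hz', norm_neg, norm_one]
    linarith
  · -- `μ = −q` again (`n − 1 = q`): `z = −1`
    exfalso
    have h' : ((q : ℂ) + 1) * μ * (((q : ℂ) + 1)⁻¹ + ((q : ℂ) + 1)⁻¹ * ((q : ℂ) + 1 - 1) * μ⁻¹) = μ + (q : ℂ) := by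
      field_simp
      ring
    rw [h, mul_zero] at h'
    have hμ' : μ = -(q : ℂ) := by linear_combination -h'
    have e := hzinv _ (hμ.symm.trans hμ')
    have hz' : z = -1 := by
      rw [← inv_inv z, e]
      field_simp
    have : ‖z‖ = 1 := by rw [hz', norm_neg, norm_one]
    linarith

/-! ## §2 The criterion's four-way disjunction, place-free -/

variable (L : Type) [Field L] [NumberField L] [IsCMField L] (v : HeightOneSpectrum (𝓞 ↥(maximalRealSubfield L)))
  (w : PlacesOver L v) (hw : IsCMField.complexConj L • w.1 = w.1)
  (eA : Gqs L v ≃ₜ* ↥(unitaryGroupOfForm (galAdicCompletionMap (L := L) (IsCMField.complexConj L) hw) ((StdForm.antidiagonal 3).over (w.1.adicCompletion L))))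
  (heA : ∀ g : Gqs L v,
    ((eA g : ↥(unitaryGroupOfForm (galAdicCompletionMap (L := L) (IsCMField.complexConj L) hw) ((StdForm.antidiagonal 3).over (w.1.adicCompletion L)))) : GL (Fin 3) (w.1.adicCompletion L)) =
      ((localNonsplitEquiv (IsCMField.complexConj L) (qsForm L) (IsCMField.complexConj_ne_one L) w hw g :
        ↥(unitaryGroupOfForm (galAdicCompletionMap (L := L) (IsCMField.complexConj L) hw) (placeForm (qsForm L) w.1))) : GL (Fin 3) (w.1.adicCompletion L)))

include heA in
set_option maxHeartbeats 16000000 in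
set_option synthInstance.maxHeartbeats 400000 in
-- statement∕proof-heavy: the `SmoothInd` carrier of `cmPrincipalSeries`, two averages, the criterion (class of ★ II-2b §4 ∕ ★ II-3″)
/-- **THE CRITERION INSTANTIATED, PLACE-FREE.**  `v` non-split ((G3)-EXPLICIT letters over the uniformiser token `hϖ`; unramified OR ramified), `χ = (χ₁, χ₂)` continuous, REGULAR, `χ` and `wχ` trivial on `T ∩ K_v`, `⊥ ≠ N ≠ ⊤` a `G_v`-stable subspace of
`i_G(χ)`, `d ∈ B_v` with `d·w̃ ∈ K₁`, `R`, `R′` left transversals of `K₀ ∕ I`, `K₁ ∕ I`; put `μ = χ(proj d)·δ_B^{1∕2}(d)`, `n = |R|`, `m = |R′|`.  Then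
`n⁻¹·m⁻¹μ − n⁻¹(n−1)·m⁻¹(m−1) = 0 ∨ μ⁻¹ = 1 ∨ m⁻¹(m−1) + m⁻¹μ = 0 ∨ n⁻¹ + n⁻¹(n−1)μ⁻¹ = 0` — ★ `criterion_of_iwahoriLine` fed with ★ II-1 `exists_iwahoriPair`
(the plane), ★ II-3″ `exists_iwahoriLine` (the line), ★ `avgProjLinear` at `K₀`, `K₁` (preserving `N`, ★ `avgProj_eq`; landing in the spherical lines ★ II-1 `eq_smul_of_mem_fixedPoints_K0 ∕ _K1`;
acting by the forms ★ II-2a `avgProj_K0_eq` ∕ ★ II-2b `avgProj_K1_eq`). [cite: Casselman1980, §3] [cite: Borel1976, §4] [cite: Keys1984, §7 Theorem (2)] -/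
theorem criterion_of_data (hns : ∀ w' : PlacesOver L v, IsCMField.complexConj L • w'.1 = w'.1) {ϖ : w.1.adicCompletion L}
    (hϖ : Valued.v ϖ = WithZero.exp (-1 : ℤ))
    (g₁ : GL (Fin 3) (w.1.adicCompletion L)) (hg₁ : (g₁ : Matrix (Fin 3) (Fin 3) (w.1.adicCompletion L)) = Matrix.diagonal ![(1 : w.1.adicCompletion L), 1, ϖ])
    (K0 K1 I : Subgroup (Gqs L v))
    (hK0 : K0 = ((glInt 3 (w.1.adicCompletion L)).subgroupOf
      (unitaryGroupOfForm (galAdicCompletionMap (L := L) (IsCMField.complexConj L) hw) ((StdForm.antidiagonal 3).over (w.1.adicCompletion L)))).comap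
        eA.toMulEquiv.toMonoidHom)
    (hK1 : K1 = (((glInt 3 (w.1.adicCompletion L)).map (MulAut.conj g₁).toMonoidHom).subgroupOf
      (unitaryGroupOfForm (galAdicCompletionMap (L := L) (IsCMField.complexConj L) hw) ((StdForm.antidiagonal 3).over (w.1.adicCompletion L)))).comap
        eA.toMulEquiv.toMonoidHom)
    (hI : I = K0 ⊓ K1)
    (χ₁ : (LocalRing L v)ˣ →* ℂˣ) (χ₂ : ↥(normOneUnits (conjLocal L (IsCMField.complexConj L) v)) →* ℂˣ)
    (h₁ : Continuous fun x => ((χ₁ x : ℂˣ) : ℂ)) (h₂ : Continuous fun x => ((χ₂ x : ℂˣ) : ℂ))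
    (hreg : cmTorusCharPair L v χ₁ χ₂ ≠ cmTorusCharPair L v (conjInvChar (conjLocal L (IsCMField.complexConj L) v) χ₁) χ₂)
    (hU : ∀ t : ↥(torusU (conjLocal L (IsCMField.complexConj L) v) (cmLocalForm L 3 v)),
      (t : ↥(unitaryGroupOfForm (conjLocal L (IsCMField.complexConj L) v) (cmLocalForm L 3 v))) ∈ cmLocalIntegralLevel L 3 (qsForm L) v → cmTorusCharPair L v χ₁ χ₂ t = 1)
    (hUw : ∀ t : ↥(torusU (conjLocal L (IsCMField.complexConj L) v) (cmLocalForm L 3 v)),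
      (t : ↥(unitaryGroupOfForm (conjLocal L (IsCMField.complexConj L) v) (cmLocalForm L 3 v))) ∈ cmLocalIntegralLevel L 3 (qsForm L) v →
        cmTorusCharPair L v (conjInvChar (conjLocal L (IsCMField.complexConj L) v) χ₁) χ₂ t = 1)
    (N : Subrepresentation (cmPrincipalSeries L 3 v (cmTorusCharPair L v χ₁ χ₂))) (hbot : N ≠ ⊥) (htop : N ≠ ⊤)
    (d : ↥(cmBorelTriple L 3 v).P) (hdK1 : (d : ↥(unitaryGroupOfForm (conjLocal L (IsCMField.complexConj L) v) (cmLocalForm L 3 v))) * (![(1 : ↥(unitaryGroupOfForm (conjLocal L (IsCMField.complexConj L) v) (cmLocalForm L 3 v))), eA.symm (weylLongU (galAdicCompletionMap (L := L) (IsCMField.complexConj L) hw) (rfl : (StdForm.antidiagonal 3).over (w.1.adicCompletion L) = _))] 1) ∈ K1)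
    (R : Finset (Gqs L v)) (hR : IsLeftTransversal K0 (K0 ⊓ I) R) (R' : Finset (Gqs L v)) (hR' : IsLeftTransversal K1 (K1 ⊓ I) R') :
    haveI := locallyCompactSpace_cmBorelU L 3 v
    (R.card : ℂ)⁻¹ * ((R'.card : ℂ)⁻¹ * ((((cmTorusCharPair L v χ₁ χ₂) ((cmBorelTriple L 3 v).proj d) : ℂˣ) : ℂ) * ((rootDeltaChar (cmBorelTriple L 3 v).P d : ℂˣ) : ℂ))) -
          (R.card : ℂ)⁻¹ * ((R.card : ℂ) - 1) * ((R'.card : ℂ)⁻¹ * ((R'.card : ℂ) - 1)) = 0 ∨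
      ((((cmTorusCharPair L v χ₁ χ₂) ((cmBorelTriple L 3 v).proj d) : ℂˣ) : ℂ) * ((rootDeltaChar (cmBorelTriple L 3 v).P d : ℂˣ) : ℂ))⁻¹ = 1 ∨
      (R'.card : ℂ)⁻¹ * ((R'.card : ℂ) - 1) + (R'.card : ℂ)⁻¹ * ((((cmTorusCharPair L v χ₁ χ₂) ((cmBorelTriple L 3 v).proj d) : ℂˣ) : ℂ) * ((rootDeltaChar (cmBorelTriple L 3 v).P d : ℂˣ) : ℂ)) = 0 ∨
      (R.card : ℂ)⁻¹ + (R.card : ℂ)⁻¹ * ((R.card : ℂ) - 1) * ((((cmTorusCharPair L v χ₁ χ₂) ((cmBorelTriple L 3 v).proj d) : ℂˣ) : ℂ) * ((rootDeltaChar (cmBorelTriple L 3 v).P d : ℂˣ) : ℂ))⁻¹ = 0 := by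
  haveI := locallyCompactSpace_cmBorelU L 3 v
  -- the Iwahori pair and the Iwahori line
  obtain ⟨f₁, f_w, hf₁, hf_w, h11, h1w, hw1, hww⟩ := K2E3PSIwahoriBasisPF.exists_iwahoriPair L v w hw eA heA hϖ g₁ hg₁ K0 K1 I hK0 hK1 hI (cmTorusCharPair L v χ₁ χ₂) hU
  obtain ⟨u, hu0, huN, huI, hline⟩ :=
    K2E3IwahoriLinePF.exists_iwahoriLine L v w hw eA heA hns hϖ g₁ hg₁ K0 K1 I hK0 hK1 hI χ₁ χ₂ h₁ h₂ hreg hU hUw N hbot htop f₁ f_w hf₁ hf_w h11 h1w hw1 hww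
  -- the scalar `μ`
  obtain ⟨μ, hμdef⟩ : ∃ μ : ℂ, μ = (((cmTorusCharPair L v χ₁ χ₂) ((cmBorelTriple L 3 v).proj d) : ℂˣ) : ℂ) * ((rootDeltaChar (cmBorelTriple L 3 v).P d : ℂˣ) : ℂ) := ⟨_, rfl⟩
  rw [← hμdef]
  have hμ0 : μ ≠ 0 := by rw [hμdef]; exact mul_ne_zero (Units.ne_zero _) (Units.ne_zero _)
  -- linear independence of the pair (values at `1`, `w̃`)
  have hlin : LinearIndependent ℂ ![f₁, f_w] := by
    refine LinearIndependent.pair_iff.2 fun s t hst => ?_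
    have h0 : (0 : Representation.SmoothInd (cmBorelTriple L 3 v).P
        (Representation.twist (((Representation.trivial ℂ ↥(torusU (conjLocal L (IsCMField.complexConj L) v) (cmLocalForm L 3 v)) ℂ).twist (cmTorusCharPair L v χ₁ χ₂)).comp
          (cmBorelTriple L 3 v).proj) (rootDeltaChar (cmBorelTriple L 3 v).P))).toFun = 0 := by
      have h := Representation.SmoothInd.toFun_smul (0 : ℂ) f₁
      rw [zero_smul] at h
      rw [h, zero_smul]
    have h0' : ∀ g, (0 : Representation.SmoothInd (cmBorelTriple L 3 v).P
        (Representation.twist (((Representation.trivial ℂ ↥(torusU (conjLocal L (IsCMField.complexConj L) v) (cmLocalForm L 3 v)) ℂ).twist (cmTorusCharPair L v χ₁ χ₂)).comp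
          (cmBorelTriple L 3 v).proj) (rootDeltaChar (cmBorelTriple L 3 v).P))).toFun g = 0 := fun g => by rw [h0]; rfl
    have e1 : (s • f₁ + t • f_w).toFun 1 = (0 : Representation.SmoothInd (cmBorelTriple L 3 v).P
        (Representation.twist (((Representation.trivial ℂ ↥(torusU (conjLocal L (IsCMField.complexConj L) v) (cmLocalForm L 3 v)) ℂ).twist (cmTorusCharPair L v χ₁ χ₂)).comp
          (cmBorelTriple L 3 v).proj) (rootDeltaChar (cmBorelTriple L 3 v).P))).toFun 1 := by rw [hst]
    have ew : (s • f₁ + t • f_w).toFun (eA.symm (weylLongU (galAdicCompletionMap (L := L) (IsCMField.complexConj L) hw) (rfl : (StdForm.antidiagonal 3).over (w.1.adicCompletion L) = _))) =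
        (0 : Representation.SmoothInd (cmBorelTriple L 3 v).P
        (Representation.twist (((Representation.trivial ℂ ↥(torusU (conjLocal L (IsCMField.complexConj L) v) (cmLocalForm L 3 v)) ℂ).twist (cmTorusCharPair L v χ₁ χ₂)).comp
          (cmBorelTriple L 3 v).proj) (rootDeltaChar (cmBorelTriple L 3 v).P))).toFun
          (eA.symm (weylLongU (galAdicCompletionMap (L := L) (IsCMField.complexConj L) hw) (rfl : (StdForm.antidiagonal 3).over (w.1.adicCompletion L) = _))) := by rw [hst]
    rw [h0', Representation.SmoothInd.toFun_add, Representation.SmoothInd.toFun_smul, Representation.SmoothInd.toFun_smul,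
      Pi.add_apply, Pi.smul_apply, Pi.smul_apply] at e1 ew
    rw [h11, hw1, smul_eq_mul, smul_eq_mul, mul_one, mul_zero, add_zero] at e1
    rw [h1w, hww, smul_eq_mul, smul_eq_mul, mul_zero, mul_one, zero_add] at ew
    exact ⟨e1, ew⟩
  have he₀ : f₁ + f_w ≠ 0 := by
    intro h
    have := (LinearIndependent.pair_iff.1 hlin 1 1 (by rw [one_smul, one_smul]; exact h)).1
    exact one_ne_zero this
  have he₁ : f₁ + μ⁻¹ • f_w ≠ 0 := by
    intro h
    have := (LinearIndependent.pair_iff.1 hlin 1 μ⁻¹ (by rw [one_smul]; exact h)).1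
    exact one_ne_zero this
  -- the levels are compact open
  have hlev := isOpen_isCompact_levels L v w hw eA g₁ K0 K1 I hK0 hK1 hI
  have hK0c : IsCompact (K0 : Set (Gqs L v)) := hlev.1.2
  have hK1c : IsCompact (K1 : Set (Gqs L v)) := hlev.2.1.2
  -- the two averages as linear maps (smoothness read on the carrier `Gqs L v`: instance path of ★ PS-LEVELS' `IsCompact (K0 : Set (Gqs L v))`)
  have hsm : Representation.IsSmooth (G := Gqs L v) (cmPrincipalSeries L 3 v (cmTorusCharPair L v χ₁ χ₂)) :=
    F0P2pCmPrincipalSeriesInterface.isSmooth_cmPrincipalSeries L v (cmTorusCharPair L v χ₁ χ₂)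
  obtain ⟨P₀, hP₀def⟩ : ∃ P₀ : _ →ₗ[ℂ] _, P₀ = Representation.avgProjLinear (G := Gqs L v) (ρ := cmPrincipalSeries L 3 v (cmTorusCharPair L v χ₁ χ₂)) K0 hsm hK0c := ⟨_, rfl⟩
  obtain ⟨P₁, hP₁def⟩ : ∃ P₁ : _ →ₗ[ℂ] _, P₁ = Representation.avgProjLinear (G := Gqs L v) (ρ := cmPrincipalSeries L 3 v (cmTorusCharPair L v χ₁ χ₂)) K1 hsm hK1c := ⟨_, rfl⟩
  -- `e_K(N) ⊆ N`: `e_K x = |R_x|⁻¹ Σ_r r·x` (★ `avgProj_eq`) and `N` is `G_v`-stable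
  have hTv : ∀ x, ∀ t ∈ (cmPrincipalSeries L 3 v (cmTorusCharPair L v χ₁ χ₂)).stabilizerSubgroup x, (cmPrincipalSeries L 3 v (cmTorusCharPair L v χ₁ χ₂)) t x = x :=
    fun x t ht => ((cmPrincipalSeries L 3 v (cmTorusCharPair L v χ₁ χ₂)).mem_stabilizerSubgroup x t).1 ht
  have hP₀N : ∀ x ∈ N.toSubmodule, P₀ x ∈ N.toSubmodule := fun x hx => by
    obtain ⟨Rx, hRx⟩ := exists_isLeftTransversal (B := K0) hK0c (hsm x)
    rw [hP₀def, Representation.avgProjLinear_apply, Representation.avgProj_eq (G := Gqs L v) (ρ := cmPrincipalSeries L 3 v (cmTorusCharPair L v χ₁ χ₂)) hK0c (hsm x) (hTv x) hRx]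
    exact N.toSubmodule.smul_mem _ (N.toSubmodule.sum_mem fun r _ => N.apply_mem_toSubmodule r hx)
  have hP₁N : ∀ x ∈ N.toSubmodule, P₁ x ∈ N.toSubmodule := fun x hx => by
    obtain ⟨Rx, hRx⟩ := exists_isLeftTransversal (B := K1) hK1c (hsm x)
    rw [hP₁def, Representation.avgProjLinear_apply, Representation.avgProj_eq (G := Gqs L v) (ρ := cmPrincipalSeries L 3 v (cmTorusCharPair L v χ₁ χ₂)) hK1c (hsm x) (hTv x) hRx]
    exact N.toSubmodule.smul_mem _ (N.toSubmodule.sum_mem fun r _ => N.apply_mem_toSubmodule r hx)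
  have hP₀W : ∀ x, P₀ x ∈ Submodule.span ℂ ({f₁ + f_w} : Set _) := by
    intro x
    have hmem := Representation.avgProj_mem_fixedPoints (G := Gqs L v) (ρ := cmPrincipalSeries L 3 v (cmTorusCharPair L v χ₁ χ₂)) (K := K0) hK0c (hsm x)
    have h := K2E3PSIwahoriBasisPF.eq_smul_of_mem_fixedPoints_K0 L v w hw eA heA hϖ g₁ hg₁ K0 K1 I hK0 hK1 hI (cmTorusCharPair L v χ₁ χ₂) f₁ f_w _ hf₁ hf_w hmem h11 h1w hw1 hww
    rw [hP₀def, Representation.avgProjLinear_apply, h]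
    exact Submodule.smul_mem _ _ (Submodule.subset_span rfl)
  have hP₁W : ∀ x, P₁ x ∈ Submodule.span ℂ ({f₁ + μ⁻¹ • f_w} : Set _) := by
    intro x
    have hmem := Representation.avgProj_mem_fixedPoints (G := Gqs L v) (ρ := cmPrincipalSeries L 3 v (cmTorusCharPair L v χ₁ χ₂)) (K := K1) hK1c (hsm x)
    have h := K2E3PSIwahoriBasisPF.eq_smul_of_mem_fixedPoints_K1 L v w hw eA heA hϖ g₁ hg₁ K0 K1 I hK0 hK1 hI (cmTorusCharPair L v χ₁ χ₂) d hdK1 f₁ f_w _ hf₁ hf_w hmem h11 h1w hw1 hww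
    rw [← hμdef] at h
    rw [hP₁def, Representation.avgProjLinear_apply, h]
    exact Submodule.smul_mem _ _ (Submodule.subset_span rfl)
  have hP₀f : ∀ x y : ℂ, P₀ (x • f₁ + y • f_w) = ((R.card : ℂ)⁻¹ * x + ((R.card : ℂ)⁻¹ * ((R.card : ℂ) - 1)) * y) • (f₁ + f_w) := by
    intro x y
    rw [hP₀def, Representation.avgProjLinear_apply,
      K2E3ParahoricAveragePF.avgProj_K0_eq L v w hw eA heA hϖ g₁ hg₁ K0 K1 I hK0 hK1 hI (cmTorusCharPair L v χ₁ χ₂) hU R hR f₁ f_w hf₁ hf_w h11 h1w hw1 hww x y]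
    congr 1
    ring
  have hP₁f : ∀ x y : ℂ, P₁ (x • f₁ + y • f_w) = (((R'.card : ℂ)⁻¹ * ((R'.card : ℂ) - 1)) * x + ((R'.card : ℂ)⁻¹ * μ) * y) • (f₁ + μ⁻¹ • f_w) := by
    intro x y
    have h := K2E3ParahoricAveragePF.avgProj_K1_eq L v w hw eA heA hϖ g₁ hg₁ K0 K1 I hK0 hK1 hI (cmTorusCharPair L v χ₁ χ₂) hU d hdK1 R' hR' f₁ f_w hf₁ hf_w h11 h1w hw1 hww x y
    rw [← hμdef] at h
    rw [hP₁def, Representation.avgProjLinear_apply, h]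
    congr 1
    ring
  -- the criterion
  exact criterion_of_iwahoriLine N.toSubmodule f₁ f_w (f₁ + f_w) (f₁ + μ⁻¹ • f_w) hlin he₀ he₁ μ⁻¹
    ((R.card : ℂ)⁻¹) ((R.card : ℂ)⁻¹ * ((R.card : ℂ) - 1)) ((R'.card : ℂ)⁻¹ * ((R'.card : ℂ) - 1)) ((R'.card : ℂ)⁻¹ * μ)
    P₀ P₁ hP₀N hP₁N hP₀W hP₁W hP₀f hP₁f u hu0 huN huI hline

end Summit.HodgeConjecture.HodgeConjecture.Cruxes.H413.K2E3KeysThmTwoIwahoriCriterionPF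

end
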